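import Mathlib
import HarnessLib
import Summits.HubbardSuperconductivity.HubbardSuperconductivity.Theorems.KLProgrammeKLRegimeEngineV8DefsG10
import Summits.HubbardSuperconductivity.HubbardSuperconductivity.Theorems.KLProgrammeKLRegimeEngineV8PairTransferRelBarIdxHosting

/-!
# K3 ENGINE package `G`-level v10: the `addShellLog` SHAPE of `klEngGeo10` and the class-#5 SAME-PACKAGE HOSTING AT THE TOKEN
# (k3c2-p2 g14; plan g21 (R89)(2) design constraint — cell gate-hubbard-kl, stmt-HubbardSuperconductivity-20437)

WHY.  (R89)(2): the rev-11 image keys the class-#5 relative family AT the G token on both sides, and the (c) closer's step-3 glue cites p1's hosting lemmas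
(`…PairTransferRelBarIdxHosting`, p592022), which are stated at a package of the literal shape `G.addShellLog C`.  The landed token is
`klEngGeo10 := klEngGeo9.raiseCF klE5CFM = (klEngGeo8.addShellLog 2⁵²).raiseCF klE5CFM` (`…DefsG10`, p593316) — the SAME structure as
`(klEngGeo8.raiseCF klE5CFM).addShellLog 2⁵²` up to re-association of the `CF` sum (propositional, not `rfl`).  This file supplies
* §1 the commutation `GeoConsts.raiseCF_addShellLog_comm` (`(G.addShellLog C).raiseCF x = (G.raiseCF x).addShellLog C`) and
  **`klEngGeo10_eq_addShellLog : klEngGeo10 = (klEngGeo8.raiseCF klE5CFM).addShellLog (2 ^ 52)`**, with the inner package's rows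
  (`klEngGeo8_raiseCF_wf`, `_CF_nonneg`, `_phGain_nonneg`);
* §2 p1's three hosting lemmas **AT `klEngGeo10` BY NAME** (one `rw` each, no re-proof): `transferBarRelAtWF_le_transferBarAt_klEngGeo10`,
  `transferBarRelIdx_le_transferBarAt_klEngGeo10`, `pairTransferPinnedAt_compl_of_relIdx_klEngGeo10` — the step-3 glue's `exact` targets at the token
  (`C = 2⁵²`; side conditions `0 ≤ r`, `2r·15367 ≤ r′`, `2r·15367 ≤ r′·2⁵²`).
Bookkeeping only; nothing about the model is asserted; nothing asserts superconductivity.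
-/

noncomputable section

namespace Summit.HubbardSuperconductivity.HubbardSuperconductivity.Theorems.KLRegimeSplit

set_option linter.dupNamespace false -- summit = problem name (single-conjunct summit), D-0017

open Real Finset Literature.MathematicalPhysics.QuantumLattice Literature.Probability.LatticeModels
open Summit.HubbardSuperconductivity.HubbardSuperconductivity.Theorems.KLProgrammeLegKernels
open Summit.HubbardSuperconductivity.HubbardSuperconductivity.Theorems.DispersionFlow
open Summit.HubbardSuperconductivity.HubbardSuperconductivity.Theorems.EngineV8

/-! ## §1 `raiseCF` commutes with `addShellLog`; the `addShellLog` shape of `klEngGeo10` -/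

/-- **`raiseCF` and `addShellLog` commute**: `(G.addShellLog C).raiseCF x = (G.raiseCF x).addShellLog C` (the two `CF` sums re-associate; every
other field is literally the same). -/
theorem GeoConsts.raiseCF_addShellLog_comm (G : GeoConsts) (C x : ℝ) : (G.addShellLog C).raiseCF x = (G.raiseCF x).addShellLog C := by
  unfold GeoConsts.raiseCF GeoConsts.addShellLog
  congr 1
  ring

/-- **The `addShellLog` shape of the token**: `klEngGeo10 = (klEngGeo8.raiseCF klE5CFM).addShellLog (2 ^ 52)`. -/
theorem klEngGeo10_eq_addShellLog : klEngGeo10 = (klEngGeo8.raiseCF klE5CFM).addShellLog (2 ^ 52) := by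
  rw [klEngGeo10_eq, klEngGeo9_eq]
  exact GeoConsts.raiseCF_addShellLog_comm klEngGeo8 (2 ^ 52) klE5CFM

/-- The inner package `klEngGeo8.raiseCF klE5CFM` is well formed. -/
theorem klEngGeo8_raiseCF_wf : (klEngGeo8.raiseCF klE5CFM).WF := GeoConsts.raiseCF_wf klEngGeo8_wf klE5CFM_nonneg

/-- `0 ≤ (klEngGeo8.raiseCF klE5CFM).CF`. -/
theorem klEngGeo8_raiseCF_CF_nonneg : 0 ≤ (klEngGeo8.raiseCF klE5CFM).CF :=
  le_trans (le_trans (by positivity) klIsoT_pow_four_le_klEngGeo8_CF) (GeoConsts.CF_le_raiseCF klE5CFM_nonneg)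

/-- `0 ≤ (klEngGeo8.raiseCF klE5CFM).phGain n ρ` (the gains are `klEngGeo8`'s). -/
theorem klEngGeo8_raiseCF_phGain_nonneg (n : ℕ) (ρ : ℝ) : 0 ≤ (klEngGeo8.raiseCF klE5CFM).phGain n ρ := by
  rw [GeoConsts.raiseCF_phGain]
  exact klEngGeo8_wf.2.2.2.2.2.2.2.2.2.2.2.2.1 n ρ

/-! ## §2 The class-#5 same-package hosting AT `klEngGeo10` (p1's `…_sameShellLog` forms, one `rw` each) -/

section Hosting

variable {L : ℕ}

/-- **Hosting of the well-formed relative bar at `klEngGeo10`** (`0 ≤ P.Klam`, `0 ≤ r`, `r·c ≤ r′`, `r·c ≤ r′·2⁵²`, weights `0 ≤ ms ≤ c`, `ov ≤ c`). -/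
theorem transferBarRelAtWF_le_transferBarAt_klEngGeo10 {P : SplitConsts} (hK : 0 ≤ P.Klam) {c r r' : ℝ} (hr : 0 ≤ r) (hrc : r * c ≤ r')
    (hrcC : r * c ≤ r' * 2 ^ 52) (β U : ℝ) (n : ℕ) {ms ov : ℝ} (hms0 : 0 ≤ ms) (hms : ms ≤ c) (hov : ov ≤ c) (Qm k k' : TorusSite 2 L) :
    transferBarRelAtWF L klEngGeo10 P r β U n ms ov Qm k k' ≤ transferBarAt L klEngGeo10 P r' β U n Qm k k' := by
  rw [klEngGeo10_eq_addShellLog]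
  exact transferBarRelAtWF_le_transferBarAt_sameShellLog klEngGeo8_raiseCF_CF_nonneg klEngGeo8_raiseCF_phGain_nonneg hK (by positivity) hr hrc hrcC
    β U n hms0 hms hov Qm k k'

/-- **Hosting of the index bar at `klEngGeo10`** (`0 ≤ P.Klam`, `0 ≤ r`, `2r·15367 ≤ r′`, `2r·15367 ≤ r′·2⁵²`): at every label and every `m′`,
`transferBarRelIdx L klEngGeo10 P r β U n m′ ≤ transferBarAt L klEngGeo10 P r′ β U n`. -/
theorem transferBarRelIdx_le_transferBarAt_klEngGeo10 {P : SplitConsts} (hK : 0 ≤ P.Klam) {r r' : ℝ} (hr : 0 ≤ r) (hrc : 2 * r * 15367 ≤ r')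
    (hrcC : 2 * r * 15367 ≤ r' * 2 ^ 52) (β U : ℝ) (n m' : ℕ) (Qm k k' : TorusSite 2 L) :
    transferBarRelIdx L klEngGeo10 P r β U n m' Qm k k' ≤ transferBarAt L klEngGeo10 P r' β U n Qm k k' := by
  rw [klEngGeo10_eq_addShellLog]
  exact transferBarRelIdx_le_transferBarAt_sameShellLog klEngGeo8_raiseCF_CF_nonneg klEngGeo8_raiseCF_phGain_nonneg hK (by positivity) hr hrc hrcC
    β U n m' Qm k k'

variable {M : ℕ} [NeZero L] [NeZero M]

/-- **Step 3's history input with the family keyed AT `klEngGeo10`**: the index clause at the pinned pair `(s_{n,m} | s_{n,n})` of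
`PairTransferRelFamilyK5 L M klEngGeo10 P r β U μ n` gives `PairTransferPinnedAt L M klEngGeo10 P r′ β U μ n (s_{n,m})` (`0 ≤ P.Klam`, `0 ≤ r`, `2r·15367 ≤ r′`,
`2r·15367 ≤ r′·2⁵²`). -/
theorem pairTransferPinnedAt_compl_of_relIdx_klEngGeo10 {P : SplitConsts} (hK : 0 ≤ P.Klam) {r r' β U μ : ℝ} (hr : 0 ≤ r) (hrc : 2 * r * 15367 ≤ r')
    (hrcC : 2 * r * 15367 ≤ r' * 2 ^ 52) {n m : ℕ}
    (h : PairTransferRelAt L M β U μ n (transferBarRelIdx L klEngGeo10 P r β U n n)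
      (softSymbolCompl L M β μ (klFlowFrameU L M β U μ n) n m) (softSymbolCompl L M β μ (klFlowFrameU L M β U μ n) n n)) :
    PairTransferPinnedAt L M klEngGeo10 P r' β U μ n (softSymbolCompl L M β μ (klFlowFrameU L M β U μ n) n m) :=
  pairTransferPinnedAt_compl_of_relIdx_of_le h fun Qm k k' => transferBarRelIdx_le_transferBarAt_klEngGeo10 hK hr hrc hrcC β U n n Qm k k'

end Hosting

end Summit.HubbardSuperconductivity.HubbardSuperconductivity.Theorems.KLRegimeSplit

end
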